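import Literature.Algebra.Homology.CharpolyHomologyShortExact
import Mathlib.Algebra.Polynomial.Reverse
import HarnessLib

/-!
# The `det(1 − t·u)` reading: reversed characteristic polynomials of a complex and of its homology

Layer `Literature/Algebra/Homology` (pure linear algebra over Mathlib; proved theorems only, 0 definitions, 0 named facts, no instances,
no notation). The factors of a zeta function are printed as `P(t) = det(1 − t·u | V)`, i.e. as the REVERSED characteristic polynomial
`(χ(u)).reverse` (Mathlib `Polynomial.reverse`; for matrices `Matrix.reverse_charpoly : M.charpoly.reverse = M.charpolyRev`). Since `reverse`
is multiplicative over a field (`Polynomial.reverse_mul_of_domain`) and the reverse of a monic polynomial is non-zero, row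
`EulerPoincarePrinciple`'s multiplicative principle applies verbatim to `u ↦ (χ(u)).reverse ∈ K(X)ˣ`; for an endomorphism `φ` of a homological
complex of finite-dimensional vector spaces (any shape `c` with `EulerCharSigns`, finitely many non-zero terms), in `RatFunc K`:

* **`finprod_reverse_charpoly_zpow_χ_eq : ∏ᶠ i, ↑(χ(φᵢ).reverse)^{χ(i)} = ∏ᶠ i, ↑(χ(H(φ)ᵢ).reverse)^{χ(i)}`** (fed by row `CharpolyEulerPoincare`'s
  degreewise `charpoly_f_eq`, BY NAME);
* `CochainComplex.prod_reverse_charpoly_zpow_negOnePow_eq` — the `ℤ`-indexed form on `[a, b]`: `∏ₙ det(1 − tφⁿ)^{(−1)ⁿ} = ∏ₙ det(1 − tHⁿ(φ))^{(−1)ⁿ}`.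

Rows `CharpolyEulerPoincare` / `CharpolyHomologyShortExact` (the monic forms) and the tree's one-space identity
`Motives/FrobeniusTraceProofs.exp_subst_endTraceLogSeries_mul_reverse_charpoly` are NOT restated, re-derived or imported. Library only (cell
`pub-hodge-ring2`, count-neutral); proves nothing about any crux, route or conjecture.

## References

* S. Lang, *Algebra* (2002), Ch. XX §3, Thm. 3.1 (Euler–Poincaré maps). [Lang2002]
* A. Hatcher, *Algebraic Topology* (2002), §2.C, Thm. 2C.3. [HatcherAT2002]
-/

open CategoryTheory CategoryTheory.Limits Polynomial

universe v u w

namespace Literature.Algebra.Homology.HopfTrace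

variable {K : Type u} [Field K]

/-- `reverse 1 = 1`. [cite: Lang2002, Ch. XX §3] -/
theorem reverse_one_eq : (1 : K[X]).reverse = 1 := by
  rw [← C_1, reverse_C]

/-- The reverse of a characteristic polynomial is non-zero in `K(X)` (its constant coefficient is `1`). [cite: Lang2002, Ch. XX §3] -/
theorem algebraMap_reverse_charpoly_ne_zero {M : Type*} [AddCommGroup M] [Module K M] [Module.Finite K M] (f : M →ₗ[K] M) :
    algebraMap K[X] (RatFunc K) f.charpoly.reverse ≠ 0 := by
  refine (map_ne_zero_iff _ (RatFunc.algebraMap_injective K)).2 fun h => ?_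
  have h0 := congrArg (fun p : K[X] => p.coeff 0) h
  simp only [coeff_zero_reverse, f.charpoly_monic.leadingCoeff, coeff_zero] at h0
  exact one_ne_zero h0

variable {ι : Type w} {c : ComplexShape ι} (C : HomologicalComplex (ModuleCat.{v} K) c) (φ : C ⟶ C)

/-- **The reversed characteristic-polynomial Euler–Poincaré identity**: `∏ᶠ i, ↑(χ(φᵢ).reverse)^{χ(i)} = ∏ᶠ i, ↑(χ(H(φ)ᵢ).reverse)^{χ(i)}` in
`RatFunc K` — the `det(1 − t·u)` form of row `CharpolyEulerPoincare` (row `EulerPoincarePrinciple` in `(RatFunc K)ˣ` on the units of the reversed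
polynomials, fed by `charpoly_f_eq` and `Polynomial.reverse_mul_of_domain`). [cite: Lang2002, Ch. XX §3, Thm. 3.1] [cite: HatcherAT2002, Thm. 2C.3] -/
theorem finprod_reverse_charpoly_zpow_χ_eq [c.EulerCharSigns] [∀ i, Module.Finite K (C.X i)] [∀ i, Module.Finite K (C.homology i)]
    (hC : (GradedObject.finrankSupport C.X).Finite) :
    ∏ᶠ i, algebraMap K[X] (RatFunc K) (φ.f i).hom.charpoly.reverse ^ ((c.χ i : ℤ)) =
      ∏ᶠ i, algebraMap K[X] (RatFunc K) (HomologicalComplex.homologyMap φ i).hom.charpoly.reverse ^ ((c.χ i : ℤ)) := by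
  classical
  let U : ∀ {M : Type v} [AddCommGroup M] [Module K M] [Module.Finite K M], (M →ₗ[K] M) → (RatFunc K)ˣ :=
    fun f => Units.mk0 _ (algebraMap_reverse_charpoly_ne_zero f)
  have hU : ∀ {M : Type v} [AddCommGroup M] [Module K M] [Module.Finite K M] (f : M →ₗ[K] M),
      ((U f : (RatFunc K)ˣ) : RatFunc K) = algebraMap K[X] (RatFunc K) f.charpoly.reverse := fun f => rfl
  have hU1 : ∀ {M : Type v} [AddCommGroup M] [Module K M] [Module.Finite K M] (f : M →ₗ[K] M), Subsingleton M → U f = 1 :=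
    fun f _ => Units.ext (by rw [hU, charpoly_eq_one_of_subsingleton, reverse_one_eq, map_one, Units.val_one])
  have hsupp : ∀ (g : ι → (RatFunc K)ˣ), (∀ i, Subsingleton (C.X i) → g i = 1) → g.HasFiniteMulSupport := fun g hg =>
    hC.subset fun i hi => by
      simp only [GradedObject.finrankSupport, Function.mem_support, ne_eq]
      exact fun h0 => hi (hg i (Module.finrank_zero_iff.1 h0))
  have total := finprod_zpow_χ_eq_of_degreewise (c := c) (fun i => U (φ.f i).hom) (fun i => U (HomologicalComplex.homologyMap φ i).hom)
    (fun i => U ((φ.f (c.next i)).hom.restrict (mapsTo_range_d C φ i (c.next i))))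
    (fun j => U ((φ.f j).hom.restrict (mapsTo_range_d C φ (c.prev j) j)))
    (fun i => Units.ext (by
      rw [Units.val_mul, Units.val_mul, hU, hU, hU, hU, charpoly_f_eq C φ i, reverse_mul_of_domain, reverse_mul_of_domain, map_mul,
        map_mul, mul_assoc]))
    (fun j hj => Units.ext (by rw [hU, charpoly_restrict_range_d_eq_one C φ _ _ hj, reverse_one_eq, map_one, Units.val_one]))
    (fun i hi => Units.ext (by rw [hU, charpoly_restrict_range_d_eq_one C φ _ _ hi, reverse_one_eq, map_one, Units.val_one]))
    (fun i j hij => by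
      have h1 : c.prev j = i := c.prev_eq' hij
      have h2 : c.next i = j := c.next_eq' hij
      subst h1
      rw [h2])
    (hsupp _ fun i _ => hU1 _ (subsingleton_homology_of_subsingleton C i))
    (hsupp _ fun i _ => hU1 _ (by rw [Subsingleton.elim (C.d i (c.next i)).hom 0, LinearMap.range_zero]; infer_instance))
    (hsupp _ fun i _ => hU1 _ inferInstance)
  have h := congrArg (fun x : (RatFunc K)ˣ => (x : RatFunc K)) total
  simp only [coe_finprod_units_zpow _ _ (hsupp _ fun i hi => hU1 _ hi),
    coe_finprod_units_zpow _ _ (hsupp _ fun i _ => hU1 _ (subsingleton_homology_of_subsingleton C i)), hU] at h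
  exact h

end Literature.Algebra.Homology.HopfTrace

/-- **`ℤ`-indexed cochain form**: for an endomorphism `φ` of a cochain complex of finite-dimensional spaces vanishing outside `[a, b]`,
`∏_{n=a}^{b} det(1 − tφⁿ)^{(−1)ⁿ} = ∏_{n=a}^{b} det(1 − tHⁿ(φ))^{(−1)ⁿ}` in `RatFunc K` (`det(1 − t·u) = χ(u).reverse`).
[cite: Lang2002, Ch. XX §3, Thm. 3.1] [cite: HatcherAT2002, Thm. 2C.3] -/
theorem Literature.Algebra.Homology.CochainComplex.prod_reverse_charpoly_zpow_negOnePow_eq {K : Type u} [Field K]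
    (C : CochainComplex (ModuleCat.{v} K) ℤ) (φ : C ⟶ C) [∀ n, Module.Finite K (C.X n)] [∀ n, Module.Finite K (C.homology n)]
    (a b : ℤ) (hC : ∀ n, n ∉ Finset.Icc a b → IsZero (C.X n)) :
    ∏ n ∈ Finset.Icc a b, algebraMap K[X] (RatFunc K) (φ.f n).hom.charpoly.reverse ^ ((n.negOnePow : ℤ)) =
      ∏ n ∈ Finset.Icc a b, algebraMap K[X] (RatFunc K) (HomologicalComplex.homologyMap φ n).hom.charpoly.reverse ^ ((n.negOnePow : ℤ)) := by
  have h0 : ∀ n, n ∉ Finset.Icc a b → Subsingleton (C.X n) := fun n hn => ModuleCat.subsingleton_of_isZero (hC n hn)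
  have hsupp : (GradedObject.finrankSupport C.X).Finite := (Finset.Icc a b).finite_toSet.subset fun n hn => by
    by_contra hn'
    haveI := h0 n hn'
    exact hn Module.finrank_zero_of_subsingleton
  have h := Literature.Algebra.Homology.HopfTrace.finprod_reverse_charpoly_zpow_χ_eq C φ hsupp
  rw [finprod_eq_prod_of_mulSupport_subset _ (s := Finset.Icc a b), finprod_eq_prod_of_mulSupport_subset _ (s := Finset.Icc a b)] at h
  · simpa using h
  · intro n hn
    by_contra hn'
    haveI := h0 n hn'
    haveI := Literature.Algebra.Homology.HopfTrace.subsingleton_homology_of_subsingleton C n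
    exact hn (by simp only [Literature.Algebra.Homology.HopfTrace.charpoly_eq_one_of_subsingleton,
      Literature.Algebra.Homology.HopfTrace.reverse_one_eq, map_one, one_zpow])
  · intro n hn
    by_contra hn'
    haveI := h0 n hn'
    exact hn (by simp only [Literature.Algebra.Homology.HopfTrace.charpoly_eq_one_of_subsingleton,
      Literature.Algebra.Homology.HopfTrace.reverse_one_eq, map_one, one_zpow])
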